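import Mathlib
import HarnessLib

/-!
# Crux `DescentPerfectToAll` (stmt-ResolutionOfSingularities-0549) — lens 5, g9: PORT-READY scaling glue for the stub
# `stub_cleanLU3DefectNonDiscrete` (normalise `g₀ ∈ A`, `x, y ∈ A` by `p`-th power scaling)

SUPPORT workfile (res-B-lens-5 g9, 2026-08-29).  OURS · counted 0.  Nothing here proves resolution in characteristic `p`; no crux or
stub is proved here.  The port of THEOREM T (memo `CLASSBC-prank2-toric-lens5-g9.md` §2, bus CONFIRM l.85589) builds the `M`-side algebra
`A_M := k[(a_i)^p, g₀]`, which wants `g₀ ∈ A` (and the (IND)-elements `x, y ∈ A`).  This is free: replacing `g₀` by `d^p · g₀` (`d ∈ A`,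
`d ≠ 0`) does not change the `K^p`-line, the hypotheses `hg₀` / `hdefect`, nor any conclusion that depends on `c : Fin p → K` only through
`∑ c_j^p g₀^j` and the non-triviality of `c` (as `CleanLUConcl` does) — `c_j ↦ c_j d^j`.  All lemmas def-free, Mathlib-only, characteristic-free
except where `CharP` is stated.
* `exists_pthPower_smul_mem` ✓ — `K = Frac A` ⇒ `∃ d ∈ A, d ≠ 0, d^p g₀ ∈ A`;
* `forall_pow_ne_pthPower_smul_iff` ✓ — `(∀ c, c^p ≠ d^p g₀) ↔ (∀ c, c^p ≠ g₀)`;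
* `noBestApprox_pthPower_smul` ✓ — `hdefect` for `g₀` ⇒ `hdefect` for `d^p g₀`;
* `exists_repr_pthPower_smul_iff` ✓ — for ANY predicate `P : K → Prop`:
  `(∃ c, nontrivial c ∧ P (∑ c_j^p (d^p g₀)^j)) ↔ (∃ c, nontrivial c ∧ P (∑ c_j^p g₀^j))`;
* `valuation_monomial_ne_pthPower_smul_iff` ✓ — (P2)-type conditions `v (x^a y^b) ≠ v (z^p) ∀ z ≠ 0` are invariant under `x ↦ d^p x`.
Resolution of singularities in positive characteristic is NOT proved.
-/

noncomputable section

set_option linter.dupNamespace false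

namespace Summit.ResolutionOfSingularities.ResolutionOfSingularities.Cruxes.DescentPerfectToAll.CpSibling.ScalingGlue

variable {K : Type} [Field K] {Γ₀ : Type} [LinearOrderedCommGroupWithZero Γ₀]

/-- `K = Frac A` ⇒ every `g₀ ∈ K` has a `p`-th-power multiple `d^p g₀ ∈ A` with `d ∈ A`, `d ≠ 0` (`g₀ = a/b`, `d := b`). -/
theorem exists_pthPower_smul_mem {k : Type} [Field k] [Algebra k K] (A : Subalgebra k K) [IsFractionRing A K]
    {p : ℕ} (hp : 0 < p) (g₀ : K) : ∃ d : K, d ∈ A ∧ d ≠ 0 ∧ d ^ p * g₀ ∈ A := by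
  obtain ⟨a, b, hb, hab⟩ := IsFractionRing.div_surjective (A := A) g₀
  have hb0 : (b : K) ≠ 0 := by
    have := IsFractionRing.injective A K
    intro h
    have hb' : b ≠ 0 := nonZeroDivisors.ne_zero hb
    exact hb' (Subtype.ext h)
  refine ⟨b, b.2, hb0, ?_⟩
  have hg : g₀ = (a : K) / (b : K) := by rw [← hab]; rfl
  obtain ⟨n, rfl⟩ := Nat.exists_eq_succ_of_ne_zero hp.ne'
  rw [hg, pow_succ, mul_assoc, mul_div_cancel₀ _ hb0]
  exact A.mul_mem (A.pow_mem b.2 n) a.2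

/-- `g₀ ∉ K^p ⟺ d^p g₀ ∉ K^p` (`d ≠ 0`). -/
theorem forall_pow_ne_pthPower_smul_iff {p : ℕ} (g₀ d : K) (hd : d ≠ 0) :
    (∀ c : K, c ^ p ≠ d ^ p * g₀) ↔ (∀ c : K, c ^ p ≠ g₀) := by
  have hdp : d ^ p ≠ 0 := pow_ne_zero _ hd
  constructor
  · intro h c hc
    exact h (d * c) (by rw [mul_pow, hc])
  · intro h c hc
    refine h (c / d) ?_
    rw [div_pow, hc, mul_div_cancel_left₀ _ hdp]

/-- No best `p`-th power approximation for `g₀` ⇒ none for `d^p g₀` (`d ≠ 0`): `d^p g₀ − f^p = d^p (g₀ − (f/d)^p)`. -/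
theorem noBestApprox_pthPower_smul {p : ℕ} (v : Valuation K Γ₀) (g₀ d : K) (hd : d ≠ 0)
    (h : ∀ f₀ : K, ∃ f₁ : K, v (g₀ - f₁ ^ p) < v (g₀ - f₀ ^ p)) :
    ∀ f₀ : K, ∃ f₁ : K, v (d ^ p * g₀ - f₁ ^ p) < v (d ^ p * g₀ - f₀ ^ p) := by
  intro f₀
  obtain ⟨f₁, hf₁⟩ := h (f₀ / d)
  refine ⟨d * f₁, ?_⟩
  have hdp : d ^ p ≠ 0 := pow_ne_zero _ hd
  have hvd : 0 < v (d ^ p) := zero_lt_iff.mpr ((Valuation.ne_zero_iff v).mpr hdp)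
  have e1 : d ^ p * g₀ - (d * f₁) ^ p = d ^ p * (g₀ - f₁ ^ p) := by rw [mul_pow]; ring
  have e0 : d ^ p * g₀ - f₀ ^ p = d ^ p * (g₀ - (f₀ / d) ^ p) := by
    rw [div_pow, mul_sub, mul_div_cancel₀ _ hdp]
  rw [e1, e0, map_mul, map_mul]
  exact mul_lt_mul_of_pos_left hf₁ hvd

/-- Representatives of the `K^p`-line transfer: `∑ c_j^p (d^p g₀)^j = ∑ (c_j d^j)^p g₀^j`, non-triviality preserved. For ANY predicate `P`
(e.g. the three clean forms of `CleanLUConcl`, which see `c` only through the sum). -/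
theorem exists_repr_pthPower_smul_iff {p : ℕ} (g₀ d : K) (hd : d ≠ 0) (P : K → Prop) :
    (∃ c : Fin p → K, (∃ j : Fin p, (j : ℕ) ≠ 0 ∧ c j ≠ 0) ∧ P (∑ j, c j ^ p * (d ^ p * g₀) ^ (j : ℕ))) ↔
      (∃ c : Fin p → K, (∃ j : Fin p, (j : ℕ) ≠ 0 ∧ c j ≠ 0) ∧ P (∑ j, c j ^ p * g₀ ^ (j : ℕ))) := by
  have key : ∀ c : Fin p → K,
      ∑ j, c j ^ p * (d ^ p * g₀) ^ (j : ℕ) = ∑ j, (c j * d ^ (j : ℕ)) ^ p * g₀ ^ (j : ℕ) := by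
    intro c
    refine Finset.sum_congr rfl fun j _ => ?_
    rw [mul_pow, mul_pow, ← pow_mul, ← pow_mul, mul_comm p (j : ℕ)]
    ring
  constructor
  · rintro ⟨c, ⟨j, hj, hcj⟩, hP⟩
    refine ⟨fun j => c j * d ^ (j : ℕ), ⟨j, hj, mul_ne_zero hcj (pow_ne_zero _ hd)⟩, ?_⟩
    rw [← key]
    exact hP
  · rintro ⟨c, ⟨j, hj, hcj⟩, hP⟩
    refine ⟨fun j => c j / d ^ (j : ℕ), ⟨j, hj, div_ne_zero hcj (pow_ne_zero _ hd)⟩, ?_⟩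
    rw [key]
    have : (fun j : Fin p => (c j / d ^ (j : ℕ) * d ^ (j : ℕ)) ^ p * g₀ ^ (j : ℕ)) = fun j => c j ^ p * g₀ ^ (j : ℕ) := by
      funext j
      rw [div_mul_cancel₀ _ (pow_ne_zero _ hd)]
    rw [this]
    exact hP

/-- (P2)-type conditions are invariant under `p`-th power scaling of `x`: `v ((d^p x)^a y^b) = v (d^a)^p · v (x^a y^b)`. -/
theorem valuation_monomial_ne_pthPower_smul_iff {p : ℕ} (v : Valuation K Γ₀) (x y d : K) (hd : d ≠ 0) (a b : ℕ) :
    (∀ z : K, z ≠ 0 → v ((d ^ p * x) ^ a * y ^ b) ≠ v (z ^ p)) ↔ (∀ z : K, z ≠ 0 → v (x ^ a * y ^ b) ≠ v (z ^ p)) := by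
  have hda : d ^ a ≠ 0 := pow_ne_zero _ hd
  have hvda : v ((d ^ a) ^ p) ≠ 0 := (Valuation.ne_zero_iff v).mpr (pow_ne_zero _ hda)
  have e : (d ^ p * x) ^ a * y ^ b = (d ^ a) ^ p * (x ^ a * y ^ b) := by
    rw [mul_pow, ← pow_mul, ← pow_mul, mul_comm p a]; ring
  constructor
  · intro h z hz heq
    refine h (d ^ a * z) (mul_ne_zero hda hz) ?_
    rw [e, map_mul, heq, ← map_mul, ← mul_pow]
  · intro h z hz heq
    refine h (z / d ^ a) (div_ne_zero hz hda) ?_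
    rw [e, map_mul] at heq
    rw [div_pow, map_div₀, eq_div_iff hvda, mul_comm]
    exact heq

end Summit.ResolutionOfSingularities.ResolutionOfSingularities.Cruxes.DescentPerfectToAll.CpSibling.ScalingGlue

end
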